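import Mathlib
import Literature.NumberTheory.Irrationality.BrownZudilin2022.BarnesRepresentation
import Summits.KontsevichZagierPeriods.Zeta5Search.AmpleGroupInvariance
import Summits.KontsevichZagierPeriods.Zeta5Search.MomentSequences
import Summits.KontsevichZagierPeriods.Zeta5Search.Families.IntegrabilityApplications
import HarnessLib

/-!
# ζ(5) search — Brown–Zudilin's invariance (27) for the WHOLE group `G ≅ Σ₇` PROVED: `invariance_group` holds (cell `pub-zeta5`, seat ct-1 g15)

HONEST FRAMING: systematic search; no irrationality claim unless kernel-certified. Nothing in this file is an
irrationality result, a worthiness exponent or a denominator statement; no value of any integral is computed.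
It DISCHARGES the named Literature fact `Literature.NumberTheory.Irrationality.BrownZudilin2022.invariance_group`
[BrownZudilin2022, Sect. 7, eq. (27); Sect. 8, Remark 4]: for EVERY `σ ∈ Σ₇` (acting on the exponent vectors `a ∈ ℤ⁸`
through the dual slots, `slotPerm σ`) and every `a` with `a` and `σ·a` convergent,
`I(σ·a)/∏_{i∈F} h_i(σ·a)! = I(a)/∏_{i∈F} h_i(a)!`.

Route (no analytic continuation, no hypergeometric identity beyond the five generators' (27)):
1. `AmpleGroupInvariance.normalisedIntegral'_slotPerm_of_ample`: (27) holds for every `σ` at every AMPLE vector, by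
   chaining the per-generator theorem `invariance_of_converges'_holds` (ct-1 g10/g12/g13) along a word for `σ`;
   off the ample locus such chains need not exist (denom-theory-d3 g27).
2. Translation along the `G`-fixed direction `𝟙 = (1,…,1)`: `σ·(a + n·𝟙) = σ·a + n·𝟙`, and `a + n·𝟙` is ample for all
   `n ≥ C(a)`; so (27) holds at `(σ, a + n·𝟙)` for all large `n`.
3. The integrand of (1) at `a + n·𝟙` is the integrand at `a` times `g(t)ⁿ`, `g = t₁(t₂−t₁)(t₃−t₂)(t₄−t₃)(t₅−t₄)(1−t₅) /
   ((t₃−t₁)t₃(1−t₄)(t₄−t₂)(t₅−t₂)) ∈ (0,1)` on the simplex (`integrand_add_const`); hence `n ↦ I(a + n·𝟙)` is a MOMENT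
   SEQUENCE (`MomentSequences.IsMoment`), and so is each factorial normaliser `(n + h_i)!/(n+M)!` (a Beta integral).
   After clearing denominators, (27) at `a + n·𝟙` reads `L(n) = R(n)` for two moment sequences `L`, `R`.
4. `MomentSequences.IsMoment.eq_zero_of_eventually_eq`: two moment sequences agreeing for all `n ≥ C` agree at `n = 0`
   (the polynomials `1 − (1 − u^C)^k ∈ u^C·ℝ[u]` increase to `1` on `(0,1]`; dominated convergence). So `L(0) = R(0)`,
   which is (27) at `(σ, a)`.

Theorems only (plus the measurable helper `shiftRatio`/`clampRatio`, definitions of functions on `ℝ⁵`); no status word,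
no `γ`, nothing about ζ(5).
-/

noncomputable section

namespace Summit.KontsevichZagierPeriods.Zeta5Search.InvarianceGroup

open MeasureTheory Set Filter
open Literature.NumberTheory.Irrationality
open Literature.NumberTheory.Irrationality.BrownZudilin2022
open Summit.KontsevichZagierPeriods.Zeta5Search.AmpleGroupInvariance
open Summit.KontsevichZagierPeriods.Zeta5Search.MomentSequences
open Summit.KontsevichZagierPeriods.Zeta5Search.Families.Cellular (integrableOn_bz_iff openSimplex_five
  measurableSet_openSimplex integrand_bz integrand_pos pi8dual_injective)
open Equiv

/-! ### 1. The integrand of (1) along the direction `𝟙` -/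

/-- The ratio `g(t)` by which the integrand (1) is multiplied under `a ↦ a + 𝟙`, written as a product of six factors each in
`(0,1)` on the simplex: `t₁/t₃ · (t₂−t₁)/(t₃−t₁) · (t₃−t₂)/(t₄−t₂) · (t₄−t₃)/(t₅−t₂) · (t₅−t₄)/(1−t₄) · (1−t₅)`. -/
def shiftRatio (t : Fin 5 → ℝ) : ℝ :=
  (t 0 / t 2) * ((t 1 - t 0) / (t 2 - t 0)) * ((t 2 - t 1) / (t 3 - t 1)) * ((t 3 - t 2) / (t 4 - t 1)) *
    ((t 4 - t 3) / (1 - t 3)) * (1 - t 4)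

/-- `shiftRatio` is measurable. -/
theorem measurable_shiftRatio : Measurable shiftRatio := by
  unfold shiftRatio; fun_prop

/-- On the open simplex `0 < shiftRatio t ≤ 1`. -/
theorem shiftRatio_mem {t : Fin 5 → ℝ} (ht : t ∈ openSimplex) : 0 < shiftRatio t ∧ shiftRatio t ≤ 1 := by
  obtain ⟨h0, h1, h2, h3, h4, h5⟩ := ht
  have r1 : 0 < t 0 / t 2 ∧ t 0 / t 2 ≤ 1 := ⟨div_pos h0 (by linarith), div_le_one_of_le₀ (by linarith) (by linarith)⟩
  have r2 : 0 < (t 1 - t 0) / (t 2 - t 0) ∧ (t 1 - t 0) / (t 2 - t 0) ≤ 1 :=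
    ⟨div_pos (by linarith) (by linarith), div_le_one_of_le₀ (by linarith) (by linarith)⟩
  have r3 : 0 < (t 2 - t 1) / (t 3 - t 1) ∧ (t 2 - t 1) / (t 3 - t 1) ≤ 1 :=
    ⟨div_pos (by linarith) (by linarith), div_le_one_of_le₀ (by linarith) (by linarith)⟩
  have r4 : 0 < (t 3 - t 2) / (t 4 - t 1) ∧ (t 3 - t 2) / (t 4 - t 1) ≤ 1 :=
    ⟨div_pos (by linarith) (by linarith), div_le_one_of_le₀ (by linarith) (by linarith)⟩
  have r5 : 0 < (t 4 - t 3) / (1 - t 3) ∧ (t 4 - t 3) / (1 - t 3) ≤ 1 :=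
    ⟨div_pos (by linarith) (by linarith), div_le_one_of_le₀ (by linarith) (by linarith)⟩
  have r6 : 0 < 1 - t 4 ∧ 1 - t 4 ≤ 1 := ⟨by linarith, by linarith⟩
  unfold shiftRatio
  refine ⟨by
    exact mul_pos (mul_pos (mul_pos (mul_pos (mul_pos r1.1 r2.1) r3.1) r4.1) r5.1) r6.1, ?_⟩
  exact mul_le_one₀ (mul_le_one₀ (mul_le_one₀ (mul_le_one₀ (mul_le_one₀ r1.2 r2.1.le r2.2) r3.1.le r3.2)
    r4.1.le r4.2) r5.1.le r5.2) r6.1.le r6.2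

open scoped Classical in
/-- `shiftRatio` clamped to `1` off the simplex: a measurable function on `ℝ⁵` with values in `(0,1]`. -/
def clampRatio (t : Fin 5 → ℝ) : ℝ := if t ∈ openSimplex then shiftRatio t else 1

/-- The open simplex of (1) is measurable (the tree's `Families.Cellular.measurableSet_openSimplex 5`). -/
theorem measurableSet_openSimplex' : MeasurableSet openSimplex := by
  rw [← openSimplex_five]; exact measurableSet_openSimplex 5

/-- `clampRatio` is measurable. -/
theorem measurable_clampRatio : Measurable clampRatio := by
  classical
  exact Measurable.ite measurableSet_openSimplex' measurable_shiftRatio measurable_const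

/-- `clampRatio` takes values in `(0,1]`. -/
theorem clampRatio_mem (t : Fin 5 → ℝ) : 0 < clampRatio t ∧ clampRatio t ≤ 1 := by
  unfold clampRatio
  split_ifs with h
  · exact shiftRatio_mem h
  · exact ⟨one_pos, le_rfl⟩

/-- The derived exponents (2) move by `c` under `a ↦ a + c·𝟙`. -/
theorem b_add_const (a : Fin 8 → ℤ) (c : ℤ) :
    b24 (fun i => a i + c) = b24 a + c ∧ b14 (fun i => a i + c) = b14 a + c ∧ b57 (fun i => a i + c) = b57 a + c ∧
      b35 (fun i => a i + c) = b35 a + c ∧ b36 (fun i => a i + c) = b36 a + c := by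
  refine ⟨?_, ?_, ?_, ?_, rfl⟩
  · simp only [b24]; ring
  · simp only [b14]; ring
  · simp only [b57]; ring
  · simp only [b35]; ring

/-- **The integrand of (1) at `a + n·𝟙` is the integrand at `a` times `g(t)ⁿ`** on the open simplex. [BrownZudilin2022, §1 eq. (1)–(2)] -/
theorem integrand_add_const (a : Fin 8 → ℤ) (n : ℕ) {t : Fin 5 → ℝ} (ht : t ∈ openSimplex) :
    integrand (fun i => a i + (n : ℤ)) t = integrand a t * shiftRatio t ^ n := by
  obtain ⟨h0, h1, h2, h3, h4, h5⟩ := ht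
  obtain ⟨e24, e14, e57, e35, e36⟩ := b_add_const a n
  have n0 : t 0 ≠ 0 := by positivity
  have n10 : t 1 - t 0 ≠ 0 := by linarith
  have n21 : t 2 - t 1 ≠ 0 := by linarith
  have n32 : t 3 - t 2 ≠ 0 := by linarith
  have n43 : t 4 - t 3 ≠ 0 := by linarith
  have n5 : 1 - t 4 ≠ 0 := by linarith
  have n20 : t 2 - t 0 ≠ 0 := by linarith
  have n2 : t 2 ≠ 0 := by linarith
  have n3 : 1 - t 3 ≠ 0 := by linarith
  have n31 : t 3 - t 1 ≠ 0 := by linarith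
  have n41 : t 4 - t 1 ≠ 0 := by linarith
  unfold integrand
  rw [e24, e14, e57, e35, e36]
  simp only [zpow_add₀ n0, zpow_add₀ n10, zpow_add₀ n21, zpow_add₀ n32, zpow_add₀ n43, zpow_add₀ n5,
    zpow_add₀ n20, zpow_add₀ n2, zpow_add₀ n3, zpow_add₀ n31, zpow_add₀ n41, zpow_natCast]
  unfold shiftRatio
  simp only [mul_pow, div_pow]
  ring

/-! ### 2. `n ↦ I(a + n·𝟙)` is a moment sequence -/

/-- **Along the `G`-fixed direction the cellular integral is a moment sequence**: for convergent `a`,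
`I(a + n·𝟙) = ∫_{simplex} integrand(a)·gⁿ` with `0 < g ≤ 1`. [BrownZudilin2022, §1 eq. (1)] -/
theorem isMoment_cellularIntegral_add {a : Fin 8 → ℤ} (ha : Converges a) :
    IsMoment (fun n : ℕ => cellularIntegral (fun i => a i + (n : ℤ))) := by
  have hint : Integrable (integrand a) (volume.restrict openSimplex) := (integrableOn_bz_iff a).2 ha
  have hpos : ∀ᵐ t ∂(volume.restrict openSimplex), 0 ≤ integrand a t := by
    filter_upwards [ae_restrict_mem measurableSet_openSimplex'] with t ht
    rw [← integrand_bz]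
    exact (integrand_pos pi8dual_injective _ _ (by rwa [openSimplex_five])).le
  have key := IsMoment.of_density (volume.restrict openSimplex) hint hpos measurable_clampRatio clampRatio_mem
  refine (funext fun n => ?_ : (fun n : ℕ => cellularIntegral (fun i => a i + (n : ℤ))) = _) ▸ key
  unfold cellularIntegral
  refine setIntegral_congr_fun measurableSet_openSimplex' fun t ht => ?_
  rw [integrand_add_const a n ht, clampRatio, if_pos ht]

/-! ### 3. The factorial normalisers along `𝟙` -/

/-- The normaliser `∏_{i∈F} h_i(a)!` of (27), as a function of `a` (the denominator of `normalisedIntegral'`). -/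
theorem normalisedIntegral'_eq (a : Fin 8 → ℤ) :
    normalisedIntegral' a = cellularIntegral a / (Fset.map fun i => ((hForm a i).toNat.factorial : ℝ)).prod := rfl

/-- Every index of `F` lies in `1,…,28`. -/
theorem Fset_bounds : ∀ i ∈ Fset, 1 ≤ i ∧ i ≤ 28 := by decide

/-- **The normaliser at `a + n·𝟙`**: for convergent `a` (so that `h_i(a) ≥ 0`, `i ∈ F`),
`∏_{i∈F} h_i(a + n·𝟙)! = ∏_{i∈F} (n + h_i(a))!`. -/
theorem normaliser_add_const {a : Fin 8 → ℤ} (ha : Converges a) (n : ℕ) :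
    (Fset.map fun i => ((hForm (fun k => a k + (n : ℤ)) i).toNat.factorial : ℝ)).prod =
      (Fset.map fun i => ((n + (hForm a i).toNat).factorial : ℝ)).prod := by
  congr 1
  refine List.map_congr_left fun i hi => ?_
  obtain ⟨h1, h28⟩ := Fset_bounds i hi
  have hnn : 0 ≤ hForm a i := (converges_iff_hForm a).1 ha i hi
  rw [hForm_add_const a n i h1 h28]
  congr 2
  omega

/-- The normaliser is positive. -/
theorem normaliser_pos (a : Fin 8 → ℤ) : 0 < (Fset.map fun i => ((hForm a i).toNat.factorial : ℝ)).prod := by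
  apply List.prod_pos
  intro x hx
  rw [List.mem_map] at hx
  obtain ⟨i, _, rfl⟩ := hx
  positivity

/-- A product of quotients by a common denominator. -/
theorem prod_map_div_const {ι : Type*} (l : List ι) (f : ι → ℝ) (d : ℝ) :
    (l.map fun i => f i / d).prod = (l.map f).prod / d ^ l.length := by
  induction l with
  | nil => simp
  | cons i l ih => simp only [List.map_cons, List.prod_cons, ih, List.length_cons, pow_succ]; ring

/-- The list of the normalising exponents `h_i(a)`, `i ∈ F`, as naturals. -/
theorem map_toNat_le_sum (a : Fin 8 → ℤ) :
    ∀ k ∈ Fset.map (fun i => (hForm a i).toNat), k ≤ (Fset.map fun i => (hForm a i).toNat).sum :=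
  fun _ hk => List.le_sum_of_mem hk

/-! ### 4. The theorem -/

/-- **Brown–Zudilin's (27) holds for the whole group `G ≅ Σ₇`** — the named Literature fact `invariance_group` is a theorem:
for every `σ ∈ Σ₇` and every `a ∈ ℤ⁸` with `a` and `σ·a` convergent, `I(σ·a)/∏_{i∈F} h_i(σ·a)! = I(a)/∏_{i∈F} h_i(a)!`.
[BrownZudilin2022, Sect. 7, eq. (27); Sect. 8, Remark 4] -/
theorem invariance_group_holds : invariance_group := by
  intro σ a ha hb
  set b := slotPerm σ a with hb_def
  -- Step 1: (27) at all large translates along `𝟙`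
  set C : ℕ := ((hList a).map Int.natAbs).sum with hC
  have h27n : ∀ n : ℕ, C ≤ n →
      normalisedIntegral' (fun i => b i + (n : ℤ)) = normalisedIntegral' (fun i => a i + (n : ℤ)) := by
    intro n hn
    rw [hb_def, ← slotPerm_add_const]
    exact normalisedIntegral'_slotPerm_of_ample σ (ample_add_const_of_le (by exact_mod_cast hn))
  -- Step 2: the two moment sequences
  set αs : List ℕ := Fset.map fun i => (hForm a i).toNat with hαs
  set βs : List ℕ := Fset.map fun i => (hForm b i).toNat with hβs
  set M : ℕ := αs.sum + βs.sum with hM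
  have hαM : ∀ k ∈ αs, k ≤ M := fun k hk => (map_toNat_le_sum a k hk).trans (Nat.le_add_right _ _)
  have hβM : ∀ k ∈ βs, k ≤ M := fun k hk => (map_toNat_le_sum b k hk).trans (Nat.le_add_left _ _)
  set L : ℕ → ℝ := fun n => cellularIntegral (fun i => b i + (n : ℤ)) *
    (αs.map fun k => ((n + k).factorial : ℝ) / (n + M).factorial).prod with hL
  set R : ℕ → ℝ := fun n => cellularIntegral (fun i => a i + (n : ℤ)) *
    (βs.map fun k => ((n + k).factorial : ℝ) / (n + M).factorial).prod with hR
  have hLm : IsMoment L := (isMoment_cellularIntegral_add hb).mul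
    (IsMoment.list_prod αs (fun k n => ((n + k).factorial : ℝ) / (n + M).factorial)
      fun k hk => IsMoment.factorialRatio (hαM k hk))
  have hRm : IsMoment R := (isMoment_cellularIntegral_add ha).mul
    (IsMoment.list_prod βs (fun k n => ((n + k).factorial : ℝ) / (n + M).factorial)
      fun k hk => IsMoment.factorialRatio (hβM k hk))
  -- the normalisers along `𝟙`
  have hPa : ∀ n : ℕ, (Fset.map fun i => ((hForm (fun k => a k + (n : ℤ)) i).toNat.factorial : ℝ)).prod =
      (αs.map fun k => ((n + k).factorial : ℝ)).prod := fun n => by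
    rw [normaliser_add_const ha n, hαs, List.map_map]; rfl
  have hPb : ∀ n : ℕ, (Fset.map fun i => ((hForm (fun k => b k + (n : ℤ)) i).toNat.factorial : ℝ)).prod =
      (βs.map fun k => ((n + k).factorial : ℝ)).prod := fun n => by
    rw [normaliser_add_const hb n, hβs, List.map_map]; rfl
  have hlen : αs.length = βs.length := by rw [hαs, hβs, List.length_map, List.length_map]
  -- Step 3: `L n = R n` for `n ≥ C`
  have hLR : ∀ n, C ≤ n → L n = R n := by
    intro n hn
    have key := h27n n hn
    have hαpos : 0 < (αs.map fun k => ((n + k).factorial : ℝ)).prod := hPa n ▸ normaliser_pos _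
    have hβpos : 0 < (βs.map fun k => ((n + k).factorial : ℝ)).prod := hPb n ▸ normaliser_pos _
    rw [normalisedIntegral'_eq, normalisedIntegral'_eq, hPa n, hPb n, div_eq_div_iff hβpos.ne' hαpos.ne'] at key
    simp only [hL, hR, prod_map_div_const, ← hlen]
    rw [mul_div_assoc', mul_div_assoc', key]
  -- Step 4: hence `L 0 = R 0`, i.e. (27) at `(σ, a)`
  have h0 := IsMoment.eq_zero_of_eventually_eq hLm hRm hLR
  have e0a : (fun i => a i + ((0:ℕ):ℤ)) = a := funext fun i => by simp
  have e0b : (fun i => b i + ((0:ℕ):ℤ)) = b := funext fun i => by simp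
  have hPa0 : (Fset.map fun i => ((hForm a i).toNat.factorial : ℝ)).prod = (αs.map fun k => (k.factorial : ℝ)).prod := by
    simpa using hPa 0
  have hPb0 : (Fset.map fun i => ((hForm b i).toNat.factorial : ℝ)).prod = (βs.map fun k => (k.factorial : ℝ)).prod := by
    simpa using hPb 0
  have hL0 : L 0 = cellularIntegral b * ((αs.map fun k => (k.factorial : ℝ)).prod / (M.factorial : ℝ) ^ αs.length) := by
    simp only [hL, e0b, zero_add, prod_map_div_const]
  have hR0 : R 0 = cellularIntegral a * ((βs.map fun k => (k.factorial : ℝ)).prod / (M.factorial : ℝ) ^ αs.length) := by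
    simp only [hR, e0a, zero_add, prod_map_div_const, hlen]
  have hd : (M.factorial : ℝ) ^ αs.length ≠ 0 := by positivity
  rw [hL0, hR0, mul_div_assoc', mul_div_assoc', div_left_inj' hd] at h0
  rw [normalisedIntegral'_eq, normalisedIntegral'_eq, hPa0, hPb0,
    div_eq_div_iff (hPb0 ▸ normaliser_pos b).ne' (hPa0 ▸ normaliser_pos a).ne']
  exact h0

end Summit.KontsevichZagierPeriods.Zeta5Search.InvarianceGroup

end
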